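import Mathlib.Algebra.Order.Round
import Mathlib.Analysis.Calculus.ContDiff.Basic
import Literature.Analysis.FunctionSpaces.TorusPeriodization
import HarnessLib

/-!
# The nearest lattice point and lattice-periodic extension of a field given near one lattice
# point (theorems only)

Analysis/FunctionSpaces support file (everything proved; no definitions, no named facts),
companion of `TorusPeriodization.lean` / `TorusPeriodicLocalization.lean`. Coordinatewise
rounding `z ↦ latticeVec (round ∘ z)` picks, within Euclidean distance `< 1/2` of a lattice point
`k`, exactly `k` (`latticeVec_round_eq`), and commutes with lattice translations
(`latticeVec_round_add_latticeVec`). Consequently, for ANY field `E` on `ℝᵈ`, the recentred field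

  `z ↦ E (z − latticeVec (round ∘ z))`

is `ℤᵈ`-periodic (`isLatticePeriodic_recenter`), equals `E(· − k)` on the ball of radius `1/2`
about each lattice point `k` (`recenter_eq_of_norm_sub_lt`), and is smooth on the union of the
balls `‖z − k‖ < a`, `a ≤ 1/2`, as soon as `E` is smooth on `‖y‖ < a` (`contDiffOn_recenter`;
jointly in a parameter: `contDiffOn_recenter_param`). This is how a (self-similar) solution given
near the origin is planted at every lattice point before gluing with a periodic far field
([cite: CaolaboraEtAl2025, Rem. 1.5 p. 7]). [folklore]
-/

noncomputable section

open Set Function Filter Topology Metric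
open scoped ContDiff

namespace Literature.Analysis.FunctionSpaces

namespace Torus

variable {d : Type*} [Fintype d] [DecidableEq d]
variable {F : Type*} [NormedAddCommGroup F] [NormedSpace ℝ F]

/-! ### Rounding to the lattice -/

/-- Within Euclidean distance `< 1/2` of the lattice point `k`, coordinatewise rounding returns
`k`. [folklore] -/
theorem round_coord_eq {z : EuclideanSpace ℝ d} {k : d → ℤ} (hz : ‖z - latticeVec k‖ < 1 / 2)
    (i : d) : round (z i) = k i := by
  have h1 : |z i - k i| < 1 / 2 := by
    have h := PiLp.norm_apply_le (z - latticeVec k) i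
    rw [Real.norm_eq_abs, PiLp.sub_apply, latticeVec_apply] at h
    exact lt_of_le_of_lt h hz
  rw [round_eq_iff]
  rw [abs_lt] at h1
  constructor <;> linarith [h1.1, h1.2]

/-- The rounded lattice vector within distance `< 1/2` of `k` is `latticeVec k`. [folklore] -/
theorem latticeVec_round_eq {z : EuclideanSpace ℝ d} {k : d → ℤ} (hz : ‖z - latticeVec k‖ < 1 / 2) :
    latticeVec (fun i => round (z i)) = latticeVec k := by
  congr 1
  funext i
  exact round_coord_eq hz i

/-- Rounding commutes with lattice translations. [folklore] -/
theorem round_coord_add_latticeVec (z : EuclideanSpace ℝ d) (m : d → ℤ) :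
    (fun i => round ((z + latticeVec m) i)) = (fun i => round (z i)) + m := by
  funext i
  rw [PiLp.add_apply, latticeVec_apply, Pi.add_apply, round_add_intCast]

/-- `latticeVec (round (z + m)) = latticeVec (round z) + latticeVec m`. [folklore] -/
theorem latticeVec_round_add_latticeVec (z : EuclideanSpace ℝ d) (m : d → ℤ) :
    latticeVec (fun i => round ((z + latticeVec m) i)) = latticeVec (fun i => round (z i)) + latticeVec m := by
  rw [round_coord_add_latticeVec, latticeVec_add]

/-! ### Recentring a field at every lattice point -/

section Recenter

variable (E : EuclideanSpace ℝ d → F)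

omit [NormedAddCommGroup F] [NormedSpace ℝ F] in
/-- Invariance under all lattice translations. [folklore] -/
theorem recenter_add_latticeVec (z : EuclideanSpace ℝ d) (m : d → ℤ) :
    E (z + latticeVec m - latticeVec fun i => round ((z + latticeVec m) i)) =
      E (z - latticeVec fun i => round (z i)) := by
  rw [latticeVec_round_add_latticeVec, add_sub_add_right_eq_sub]

omit [NormedAddCommGroup F] [NormedSpace ℝ F] in
/-- **Periodicity** of the recentred field `z ↦ E(z − latticeVec (round z))`. [folklore] -/
theorem isLatticePeriodic_recenter :
    IsLatticePeriodic fun z => E (z - latticeVec fun i => round (z i)) := by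
  intro j z
  have h := recenter_add_latticeVec E z (Pi.single j 1)
  rw [latticeVec_single] at h
  exact h

omit [NormedAddCommGroup F] [NormedSpace ℝ F] in
/-- **Local formula**: on the ball of radius `1/2` about the lattice point `k` the recentred
field is `E(· − k)`. [folklore] -/
theorem recenter_eq_of_norm_sub_lt {z : EuclideanSpace ℝ d} {k : d → ℤ}
    (hz : ‖z - latticeVec k‖ < 1 / 2) :
    E (z - latticeVec fun i => round (z i)) = E (z - latticeVec k) := by
  rw [latticeVec_round_eq hz]

/-- **Smoothness** of the recentred field on the union of the balls `‖z − k‖ < a`, `a ≤ 1/2`,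
when `E` is `Cⁿ` on `‖y‖ < a`. [folklore] -/
theorem contDiffOn_recenter {n : WithTop ℕ∞} {a : ℝ} (ha : a ≤ 1 / 2)
    (hE : ContDiffOn ℝ n E (ball 0 a)) :
    ContDiffOn ℝ n (fun z => E (z - latticeVec fun i => round (z i)))
      {z | ∃ k : d → ℤ, ‖z - latticeVec k‖ < a} := by
  refine contDiffOn_of_locally_contDiffOn fun z hz => ?_
  obtain ⟨k, hk⟩ := hz
  refine ⟨ball (latticeVec k) a, isOpen_ball, by rwa [mem_ball, dist_eq_norm], ?_⟩
  have hsub : {z : EuclideanSpace ℝ d | ∃ k : d → ℤ, ‖z - latticeVec k‖ < a} ∩ ball (latticeVec k) a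
      ⊆ ball (latticeVec k) a := inter_subset_right
  refine ContDiffOn.mono ?_ hsub
  have h1 : ContDiffOn ℝ n (fun z => E (z - latticeVec k)) (ball (latticeVec k) a) := by
    refine hE.comp (contDiffOn_id.sub contDiffOn_const) fun w hw => ?_
    rw [mem_ball, dist_eq_norm] at hw
    simpa using hw
  refine h1.congr fun w hw => ?_
  rw [mem_ball, dist_eq_norm] at hw
  exact recenter_eq_of_norm_sub_lt E (lt_of_lt_of_le hw ha)

/-- **Joint smoothness with a parameter** (e.g. time): if `(s, y) ↦ E s y` is `Cⁿ` on
`S × {‖y‖ < a}`, `a ≤ 1/2`, then `(s, z) ↦ E s (z − latticeVec (round z))` is `Cⁿ` on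
`S × ⋃ₖ {‖z − k‖ < a}`. [folklore] -/
theorem contDiffOn_recenter_param {n : WithTop ℕ∞} {a : ℝ} (ha : a ≤ 1 / 2) {S : Set ℝ}
    {G : ℝ → EuclideanSpace ℝ d → F}
    (hG : ContDiffOn ℝ n (fun p : ℝ × EuclideanSpace ℝ d => G p.1 p.2) (S ×ˢ ball 0 a)) :
    ContDiffOn ℝ n (fun p : ℝ × EuclideanSpace ℝ d => G p.1 (p.2 - latticeVec fun i => round (p.2 i)))
      (S ×ˢ {z | ∃ k : d → ℤ, ‖z - latticeVec k‖ < a}) := by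
  refine contDiffOn_of_locally_contDiffOn fun p hp => ?_
  obtain ⟨k, hk⟩ := hp.2
  refine ⟨univ ×ˢ ball (latticeVec k) a, isOpen_univ.prod isOpen_ball,
    ⟨mem_univ _, by rwa [mem_ball, dist_eq_norm]⟩, ?_⟩
  have hsub : (S ×ˢ {z : EuclideanSpace ℝ d | ∃ k : d → ℤ, ‖z - latticeVec k‖ < a}) ∩
      (univ ×ˢ ball (latticeVec k) a) ⊆ S ×ˢ ball (latticeVec k) a := by
    rintro ⟨s, w⟩ ⟨h1, h2⟩
    exact ⟨h1.1, h2.2⟩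
  refine ContDiffOn.mono ?_ hsub
  have h1 : ContDiffOn ℝ n (fun p : ℝ × EuclideanSpace ℝ d => G p.1 (p.2 - latticeVec k))
      (S ×ˢ ball (latticeVec k) a) := by
    have hmap : ContDiffOn ℝ n (fun p : ℝ × EuclideanSpace ℝ d => (p.1, p.2 - latticeVec k))
        (S ×ˢ ball (latticeVec k) a) :=
      (contDiffOn_fst.prodMk (contDiffOn_snd.sub contDiffOn_const))
    refine hG.comp hmap ?_
    rintro ⟨s, w⟩ ⟨hs, hw⟩
    rw [mem_ball, dist_eq_norm] at hw
    exact ⟨hs, by simpa using hw⟩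
  refine h1.congr ?_
  rintro ⟨s, w⟩ ⟨hs, hw⟩
  rw [mem_ball, dist_eq_norm] at hw
  show G s (w - latticeVec fun i => round (w i)) = G s (w - latticeVec k)
  rw [latticeVec_round_eq (lt_of_lt_of_le hw ha)]

end Recenter

end Torus

end Literature.Analysis.FunctionSpaces
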